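import Literature.NumberTheory.EllipticCurves.CreutzMiller2012.SecondIsogenyDescentShaTrivial
import Summits.BirchSwinnertonDyer.Rank1Residual.LW16.DescentReRouteShape
import HarnessLib

/-!
# LW16 re-route — RECORDS (CM12): `BSD(E,5)` PER PAIR for the three RESIDUE register cells
# `(1050o, 5)`, `(1950y, 5)`, `(2550be, 5)` from Creutz–Miller 2012 §7.1 (`Ш(E/ℚ)[5] = 0` by a
# second `φ`-descent, PRINTED per curve) + GZK + the lane's `ord_5 #Ш_an = 0`

HONEST FRAMING (programme BSD-LIT2PART v1 §T3; cell `pub/bsd-litref/lw16`; seat `bsd-litref-lw16-pv`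
g5 «consumer re-route to the undisputed form»): nothing here proves BSD; these are PER-PAIR theorems
(OFFERS — the referee books, nothing is booked here). The three cells are RESIDUE open cells
`(class, 5)` of referee A2 state R927 (`pub-bsdpct-r5-g9/scratchA2_state_after_resiso_w7_fold.pkl`
bd330ed9e7a3c0af / 8e6c4cc5cbe7f26c; netted MOVER — open at `5`, sole open cell, no token — by the
filer with `tools-lead/wavelib.net_cell`), residual class X3 (ADDITIVE at `5`: `N = 2·3·5²·7`,
`2·3·5²·13`, `2·3·5²·17`; `E[5]` reducible: `E(ℚ) ≅ ℤ/5` on curve 1; `r = 0`; `#Ш_an(curve 1) = 1`,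
`#Ш_an(curve 2) = 25`): the RESISO production first descent left them RESISTANT (EXCESS 2 on the
`5`-isogenous curve, `lw16/eng/resiso-pv/out-prod/RESISO-prod-verdicts.tsv` 7802d01c), and the hub's
Cassels–Tate pairing engines at `p = 5` (x1b `ctp5`/`ctp5b`, scope `5 ∤ N`) do not reach them. In
PRINT they are three of the ELEVEN classes of Creutz–Miller, J. Algebra 372 (2012), Table 1, closed in
§7.1 ("Proof of Theorem 1.1") by a SECOND `φ`-descent: "`φ(Ш(E/ℚ)[ℓ]) = 0` and hence `Ш(E/ℚ)[ℓ] = 0`"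
for the optimal curve `E` — a pure descent computation (Magma), independent of every Kolyvagin /
Heegner-index statement and hence of the disputed GJPST 2009 Thm. 3.7 / Lawson–Wuthrich 2016 Thm. 14
(flag `LW16-Thm14-disputed-MN19-0.11`); vendored as the named fact
`CreutzMiller2012.sha_torsion_eq_zero_of_mem` (PUB, statement only, taken here as the hypothesis
`hCM`). Each record composes it, BY NAME, with the lane's kernel shape
`LW16.bsdp_rankZero_of_ainvs_of_noPTorsionSha` (p458836) over `Typed.bsdp_of_shaAn_unit_of_noPTorsion`:
`BSD(E,5)` ⟸ PUBLISHED `hCM` + PUBLISHED `hGZK` (Gross–Zagier–Kolyvagin, bsd.S17) + `r_an = 0`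
(`hr`, Cremona) + `#Ш_an = q`, `ord_5 q = 0` (`hq`/`hv`, READ from Cremona `allbsd`: the
modular-symbol value `L(E,1)·#tors²/(Ω·∏c) = 1`; second reading `shaan_own` kit j290xxx of the
filer in the offer's cells table) — NO descent-certificate hypothesis, NO image / Heegner / torsion
binder; membership of the literal model in the printed list by `List.Mem` unfolding. Precedent of the
shape: `X12/MillerStollRecords.lean` (Miller–Stoll 2013 Thm. 9.1 per-curve list, referee-booked).
PER PAIR; OFFER (the desk books; tier = the desk's word on a computer-assisted per-curve print);
nothing else changes. Theorems only; no definition, no named fact, no `sorry`; imports = the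
Creutz–Miller fact file + the kernel module + HarnessLib (no route file).

References: [CreutzMiller2012] Thm. 1.1, Table 1, §7.1–7.2; [MillerStoll2013] §9 (the eleven pairs
named); [Miller2011LMS] §1, Def. 1.1; [Cremona1997] Table 1 (`allcurves`, `allbsd`).
-/

set_option autoImplicit false

noncomputable section

open scoped Classical

open WeierstrassCurve Literature.NumberTheory.EllipticCurves
open Literature.NumberTheory.EllipticCurves.CreutzMiller2012
open Summit.BirchSwinnertonDyer.Rank1Residual.LW16

namespace Summit.BirchSwinnertonDyer.Rank1Residual.LW16

/-- `(1050o1, 5)` is the 3rd entry of Creutz–Miller's list. [cite: CreutzMiller2012, Table 1 and §7.1] -/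
theorem mem_shaTrivialOptimalCurves_cremona1050o1 :
    ((⟨((1 : ℤ) : ℚ), ((0 : ℤ) : ℚ), ((0 : ℤ) : ℚ), ((22 : ℤ) : ℚ), ((-2748 : ℤ) : ℚ)⟩ :
      WeierstrassCurve ℚ), 5) ∈ shaTrivialOptimalCurves :=
  .tail _ <| .tail _ <| .head _

/-- `(1950y1, 5)` is the 5th entry of Creutz–Miller's list. [cite: CreutzMiller2012, Table 1 and §7.1–7.2] -/
theorem mem_shaTrivialOptimalCurves_cremona1950y1 :
    ((⟨((1 : ℤ) : ℚ), ((0 : ℤ) : ℚ), ((0 : ℤ) : ℚ), ((-355303 : ℤ) : ℚ), ((-89334583 : ℤ) : ℚ)⟩ :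
      WeierstrassCurve ℚ), 5) ∈ shaTrivialOptimalCurves :=
  .tail _ <| .tail _ <| .tail _ <| .tail _ <| .head _

/-- `(2550be1, 5)` is the 7th entry of Creutz–Miller's list. [cite: CreutzMiller2012, Table 1 and §7.1] -/
theorem mem_shaTrivialOptimalCurves_cremona2550be1 :
    ((⟨((1 : ℤ) : ℚ), ((0 : ℤ) : ℚ), ((0 : ℤ) : ℚ), ((-1628 : ℤ) : ℚ), ((432 : ℤ) : ℚ)⟩ :
      WeierstrassCurve ℚ), 5) ∈ shaTrivialOptimalCurves :=
  .tail _ <| .tail _ <| .tail _ <| .tail _ <| .tail _ <| .tail _ <| .head _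

/-- ROW `(1050o, 5)`: RESIDUE open cell `X3` — `1050o1` `[1,0,0,22,-2748]` (curve 1 = the optimal curve), `N = 1050 =
2·3·5²·7`, additive at `5`, `E[5]` reducible (`E(ℚ) ≅ ℤ/5`), `r = 0`, `#tors = 5`, `∏c = 125`, `#Ш_an = 1` (`ord_5 = 0`;
hq/hv; `5`-isogenous curve `1050o2` `[1,0,0,-109388,-13934358]` has `#Ш_an = 25`). CERT LINE `Ш(E)[5] = 0` SUPPLIED BY
PRINT: Creutz–Miller 2012 §7.1 (second `φ`-descent on the nontrivial elements of `Ш(E′/ℚ)[φ′]`, `Sel^{(φ)}(C/ℚ) = ∅` ⇒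
`φ(Ш(E/ℚ)[5]) = 0` ⇒ `Ш(E/ℚ)[5] = 0`), named fact `hCM` at the 3rd entry of its list; no engine certificate is claimed
(RESISO first descent: RESISTANT, EXCESS 2 on `Ê`).
[cite: CreutzMiller2012, §7.1 and Table 1] [cite: Miller2011LMS, §1 and Def. 1.1] [cite: Cremona1997, Table 1 (Cremona label 1050o1)] -/
theorem bsdp5_cm12_1050o1 (hCM : sha_torsion_eq_zero_of_mem)
    (hGZK : rank_eq_analyticRank_of_analyticRank_le_one)
    (W : WeierstrassCurve ℚ) (hWm : W = ⟨1, 0, 0, 22, -2748⟩) (hr : W.analyticRank = 0)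
    {q : ℚ} (hq : shaAn W = (q : ℂ)) (hv : padicValRat 5 q = 0) : BSDp W 5 := by
  subst hWm
  haveI : Fact (Nat.Prime 5) := ⟨by norm_num⟩
  exact bsdp_rankZero_of_ainvs_of_noPTorsionSha hGZK 1 0 0 22 (-2748) 5 (by decide +kernel) hr hq hv
    (fun x hx ↦ hCM _ 5 mem_shaTrivialOptimalCurves_cremona1050o1 x (by rwa [natCast_zsmul] at hx))

/-- ROW `(1950y, 5)`: RESIDUE open cell `X3` — `1950y1` `[1,0,0,-355303,-89334583]` (curve 1 = the optimal curve), `N =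
1950 = 2·3·5²·13`, additive at `5`, `E[5]` reducible (`E(ℚ) ≅ ℤ/5`), `r = 0`, `#tors = 5`, `∏c = 1000`, `#Ш_an = 1`
(`ord_5 = 0`; hq/hv; `5`-isogenous curve `1950y2` `[1,0,0,-227906263,-1324307174983]` has `#Ш_an = 25`). CERT LINE
`Ш(E)[5] = 0` SUPPLIED BY PRINT: Creutz–Miller 2012 §7.2 "The pair (1950y, 5)" worked in full (`Sel^{(φ)}(E′/ℚ) = 0`,
`Sel^{(φ′)}(E/ℚ) = ⟨2, 3, 13⟩ ⊂ ℚ^×/ℚ^{×5}`, `dim Ш(E′/ℚ)[φ′] = 2`; second `φ`-descent on the covering `C` of `2^{±1}`: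
fake `φ`-Selmer set empty ⇒ `Ш(E/ℚ)[5] = 0`), named fact `hCM` at the 5th entry of its list; no engine certificate is
claimed (RESISO first descent: RESISTANT, EXCESS 2 on `Ê`).
[cite: CreutzMiller2012, §7.2 and Table 1] [cite: Miller2011LMS, §1 and Def. 1.1] [cite: Cremona1997, Table 1 (Cremona label 1950y1)] -/
theorem bsdp5_cm12_1950y1 (hCM : sha_torsion_eq_zero_of_mem)
    (hGZK : rank_eq_analyticRank_of_analyticRank_le_one)
    (W : WeierstrassCurve ℚ) (hWm : W = ⟨1, 0, 0, -355303, -89334583⟩) (hr : W.analyticRank = 0)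
    {q : ℚ} (hq : shaAn W = (q : ℂ)) (hv : padicValRat 5 q = 0) : BSDp W 5 := by
  subst hWm
  haveI : Fact (Nat.Prime 5) := ⟨by norm_num⟩
  exact bsdp_rankZero_of_ainvs_of_noPTorsionSha hGZK 1 0 0 (-355303) (-89334583) 5 (by decide +kernel) hr hq hv
    (fun x hx ↦ hCM _ 5 mem_shaTrivialOptimalCurves_cremona1950y1 x (by rwa [natCast_zsmul] at hx))

/-- ROW `(2550be, 5)`: RESIDUE open cell `X3` — `2550be1` `[1,0,0,-1628,432]` (curve 1 = the optimal curve), `N = 2550 =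
2·3·5²·17`, additive at `5`, `E[5]` reducible (`E(ℚ) ≅ ℤ/5`), `r = 0`, `#tors = 5`, `∏c = 125`, `#Ш_an = 1` (`ord_5 = 0`;
hq/hv; `5`-isogenous curve `2550be2` `[1,0,0,-690638,-220971858]` has `#Ш_an = 25`). CERT LINE `Ш(E)[5] = 0` SUPPLIED
BY PRINT: Creutz–Miller 2012 §7.1 (second `φ`-descent, as for every class of Table 1), named fact `hCM` at the 7th entry
of its list; no engine certificate is claimed (RESISO first descent: RESISTANT, EXCESS 2 on `Ê`).
[cite: CreutzMiller2012, §7.1 and Table 1] [cite: Miller2011LMS, §1 and Def. 1.1] [cite: Cremona1997, Table 1 (Cremona label 2550be1)] -/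
theorem bsdp5_cm12_2550be1 (hCM : sha_torsion_eq_zero_of_mem)
    (hGZK : rank_eq_analyticRank_of_analyticRank_le_one)
    (W : WeierstrassCurve ℚ) (hWm : W = ⟨1, 0, 0, -1628, 432⟩) (hr : W.analyticRank = 0)
    {q : ℚ} (hq : shaAn W = (q : ℂ)) (hv : padicValRat 5 q = 0) : BSDp W 5 := by
  subst hWm
  haveI : Fact (Nat.Prime 5) := ⟨by norm_num⟩
  exact bsdp_rankZero_of_ainvs_of_noPTorsionSha hGZK 1 0 0 (-1628) 432 5 (by decide +kernel) hr hq hv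
    (fun x hx ↦ hCM _ 5 mem_shaTrivialOptimalCurves_cremona2550be1 x (by rwa [natCast_zsmul] at hx))

end Summit.BirchSwinnertonDyer.Rank1Residual.LW16

end
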